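import Literature.AlgebraicGeometry.Motives.HyperbolicWeilType
import Literature.AlgebraicGeometry.HodgeTheory.AbelianVarietyEndomorphismsHOne
import Literature.AlgebraicGeometry.HodgeTheory.SupportedClassesRationalProofs
import Literature.AlgebraicGeometry.HodgeTheory.HardLefschetzThreefold
import Literature.AlgebraicGeometry.HodgeTheory.HolomorphicBundleChernCharacterTopDegree
import Literature.AlgebraicGeometry.Motives.AbelianVarietyProjectiveChart
import Literature.AlgebraicGeometry.Motives.ComplexPointsOrientation

/-!
# `AimedDescending` (stmt-HodgeConjecture-14643) · VII · rational degree-one models exist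

Route `HeckePrymWeil`, support item `AimedDescending`. The product-frame theorem
`isHyperbolicWeilType_prod_of_rationalModels` (file VI) consumes, for each factor `(A, φ, h_A)`,
a RATIONAL DEGREE-ONE MODEL: a rational `ℂ`-basis `u` of `H¹(A(ℂ); ℂ)`, the rational matrix `M` of
`φ^*` in it, a non-zero rational top class `ω ∈ H^{2 dim A}(A(ℂ); ℂ)`, the rational Gram matrix `G` of
the polarization pairing `Q_{h_A}(uᵢ, uⱼ) = h_A^{dim A - 1} ⌣ uᵢ ⌣ uⱼ = Gᵢⱼ · ω`, and the rational top
self-intersection `h_A^{dim A} = d · ω`. This file PROVES that such a model exists for EVERY complex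
abelian variety `A`, every endomorphism `φ` and every rational class `h_A ∈ H²(A(ℂ); ℂ)`
(`exists_rationalModel_one`), from theorems of the tree only:

* rational classes span `Hᵏ(A(ℂ); ℂ)` (`span_isRationalClass_eq_top_of_isSmoothProjective_holds`,
  Voisin I §7.1.1 / Hatcher Thm. 3.2), so `H¹` has a `ℂ`-basis of rational classes, in which every
  rational class — in particular `φ^* uᵢ` — has rational coordinates
  (`repr_mem_range_ratCast_of_isRationalClass`);
* `H^{2 dim A}(A(ℂ); ℂ)` is a line (Poincaré duality, `finrank_singularCohomology_eq_of_add_eq`,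
  and `H⁰ ≅ ℂ` on the path-connected `A(ℂ)`), spanned by a non-zero rational class `ω`; cup products
  and Lefschetz iterates of rational classes are rational (`IsRationalClass.cup`), hence rational
  multiples of `ω`.

No named fact is used; `dim H¹ = 2 dim A` (part of `Motives.abelianVarietyCohomologyExteriorH1`)
is NOT needed here and not asserted (the model has `r = dim_ℂ H¹(A(ℂ); ℂ)` vectors).
Sources: B. van Geemen, LNM 1594 (1994), 4.8 and Lemma 5.2 (2)–(3) (the rational structures
`H¹(X, ℚ)`, `E`, `det H`); Ch. Birkenhake, H. Lange, Lemma 1.1.17, Lemma 1.7.4.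
-/

noncomputable section

-- every declaration of this problem lives in `Summit.HodgeConjecture.HodgeConjecture.…`
set_option linter.dupNamespace false

open CategoryTheory
open Literature.AlgebraicGeometry Literature.AlgebraicGeometry.HodgeTheory
open Literature.AlgebraicTopology.SingularHomology
open Literature.Geometry.Kaehler

namespace Summit.HodgeConjecture.HodgeConjecture.Theorems

variable {X : Motives.SchemeOver ℂ}

/-- Lefschetz iterates of a rational class by a rational class are rational (`IsRationalClass.cup`,
induction). [cite: HatcherAT2002, §3.1 Thm. 3.2 and p. 198] -/
theorem isRationalClass_lefschetzPow {η : complexBetti X 2} (hη : IsRationalClass η) (j k : ℕ)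
    {x : complexBetti X k} (hx : IsRationalClass x) : IsRationalClass (lefschetzPow η j k x) := by
  induction j with
  | zero => exact hx
  | succ j ih =>
    rw [lefschetzPow_succ, LinearMap.comp_apply, lefschetzOperator_apply]
    exact hη.cup _ ih

/-- The polarization pairing of rational classes for a rational class is rational.
[cite: HatcherAT2002, §3.1 Thm. 3.2 and p. 198] -/
theorem isRationalClass_polarizationPairingOne {η : complexBetti X 2} (hη : IsRationalClass η) (j : ℕ)
    {x y : complexBetti X 1} (hx : IsRationalClass x) (hy : IsRationalClass y) :
    IsRationalClass (Motives.polarizationPairingOne X η j x y) := by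
  rw [Motives.polarizationPairingOne_apply]
  exact isRationalClass_lefschetzPow hη j 2 (hx.cup _ hy)

/-- **In a line spanned by a non-zero rational class, rational classes have rational
coordinates.** If `Hᵏ(X(ℂ); ℂ)` has dimension `1` and `ω ≠ 0` is rational, every rational class is
`q · ω` with `q ∈ ℚ` (`repr_mem_range_ratCast_of_isRationalClass` for the singleton basis).
[cite: HatcherAT2002, §3.1 Thm. 3.2 and p. 198] -/
theorem exists_eq_ratCast_smul_of_finrank_eq_one {k : ℕ} (h1 : Module.finrank ℂ (complexBetti X k) = 1)
    {ω : complexBetti X k} (hω : IsRationalClass ω) (hω0 : ω ≠ 0) {x : complexBetti X k}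
    (hx : IsRationalClass x) : ∃ q : ℚ, x = ((q : ℚ) : ℂ) • ω := by
  let b := FiniteDimensional.basisSingleton Unit h1 ω hω0
  have hb : ∀ i, IsRationalClass (b i) := fun i => by
    rw [FiniteDimensional.basisSingleton_apply]
    exact hω
  obtain ⟨q, hq⟩ := repr_mem_range_ratCast_of_isRationalClass b hb hx default
  refine ⟨q, ?_⟩
  have hsum := b.sum_repr x
  rw [Fintype.sum_unique, FiniteDimensional.basisSingleton_apply] at hsum
  rw [← hsum, ← hq]

/-- **`H^{2 dim A}` in the degree spelling `2 + 2 j`, `dim = j + 1`, is a line** (Poincaré duality: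
`dim H^{2+2j} = dim H⁰ = 1` on the path-connected `X(ℂ)`). [cite: HatcherAT2002, §3.3 Cor. 3.37] -/
theorem finrank_complexBetti_two_add_two_mul_eq_one {j : ℕ} (hX : Motives.IsSmoothProjective (j + 1) X) :
    Module.finrank ℂ (complexBetti X (2 + 2 * j)) = 1 := by
  haveI := pathConnectedSpace_complexPoints_of_isSmoothProjective hX
  change Module.finrank ℂ (singularCohomology ℂ ℂ (Motives.ComplexPoints X) (2 + 2 * j)) = 1
  rw [Motives.ComplexPoints.finrank_singularCohomology_eq_of_add_eq ℂ hX
    (show (2 + 2 * j) + 0 = 2 * (j + 1) by omega),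
    (singularCohomologyZeroEquiv ℂ ℂ (Motives.ComplexPoints X)).finrank_eq, Module.finrank_self]

/-- A non-zero rational class exists in the line `H^{2+2j}(X(ℂ); ℂ)`, `dim X = j + 1` (rational
classes span). [cite: VoisinHodgeI2002, §7.1.1] -/
theorem exists_isRationalClass_ne_zero_two_add_two_mul {j : ℕ} (hX : Motives.IsSmoothProjective (j + 1) X) :
    ∃ ω : complexBetti X (2 + 2 * j), IsRationalClass ω ∧ ω ≠ 0 := by
  have h1 := finrank_complexBetti_two_add_two_mul_eq_one hX
  by_contra h
  have h' : ∀ c : complexBetti X (2 + 2 * j), IsRationalClass c → c = 0 :=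
    fun c hc ↦ by_contra fun hne ↦ h ⟨c, hc, hne⟩
  have hbot : Submodule.span ℂ {c : complexBetti X (2 + 2 * j) | IsRationalClass c} = ⊥ :=
    Submodule.span_eq_bot.2 fun c hc ↦ h' c hc
  have htop := span_isRationalClass_eq_top_of_isSmoothProjective_holds (j + 1) X hX (2 + 2 * j)
  rw [hbot] at htop
  have h0 : Module.finrank ℂ (complexBetti X (2 + 2 * j)) = 0 := by
    rw [← finrank_top ℂ (complexBetti X (2 + 2 * j)), ← htop, finrank_bot]
  omega

variable {A : Motives.AbelianVariety ℂ}

/-- **Rational degree-one models exist.** For a complex abelian variety `A` of dimension `j + 1`,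
an endomorphism `φ` and a RATIONAL class `η ∈ H²(A(ℂ); ℂ)` there are: a rational `ℂ`-basis
`u : Fin r → H¹(A(ℂ); ℂ)` (rational classes, `ℂ`-independent, spanning), a rational matrix `M` with
`φ^* uᵢ = Σ_k M k i • u_k`, a non-zero rational class `ω ∈ H^{2+2j}(A(ℂ); ℂ) = H^{2 dim A}`, a rational
matrix `G` with `Q_{η, j}(uᵢ, u_k) = ηʲ ⌣ uᵢ ⌣ u_k = G i k • ω` and a rational `d` with
`L^j_η η = η^{j+1} = d • ω` — the "rational model" consumed by `isHyperbolicWeilType_prod_of_rationalModels`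
(van Geemen, LNM 1594, 4.8 and Lemma 5.2 (2)–(3): the rational structures `H¹(X, ℚ)`, `E`, `det H`).
Everything from theorems of the tree (module docstring). [cite: vanGeemen1994HodgeAV, 4.8 and Lemma 5.2 (2)–(3)] -/
theorem exists_rationalModel_one (φ : A ⟶ A) {j : ℕ} (hA : A.dim = j + 1) (η : complexBetti A.X 2)
    (hη : IsRationalClass η) :
    ∃ (r : ℕ) (u : Fin r → complexBetti A.X 1) (M : Matrix (Fin r) (Fin r) ℚ)
      (ω : complexBetti A.X (2 + 2 * j)) (G : Matrix (Fin r) (Fin r) ℚ) (d : ℚ),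
      (∀ i, IsRationalClass (u i)) ∧ LinearIndependent ℂ u ∧ Submodule.span ℂ (Set.range u) = ⊤ ∧
      (∀ i, complexBetti.map φ.hom.hom.hom 1 (u i) = ∑ k, ((M k i : ℚ) : ℂ) • u k) ∧
      IsRationalClass ω ∧ ω ≠ 0 ∧
      (∀ i k, Motives.polarizationPairingOne A.X η j (u i) (u k) = ((G i k : ℚ) : ℂ) • ω) ∧
      lefschetzPow η j 2 η = ((d : ℚ) : ℂ) • ω := by
  classical
  have hX : Motives.IsSmoothProjective (j + 1) A.X := by
    have h := Motives.AbelianVariety.isSmoothProjective_holds (A := A)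
    rw [Motives.AbelianVariety.isSmoothProjective, hA] at h
    exact h
  haveI : Module.Finite ℂ (complexBetti A.X 1) := finite_complexBetti_abelianVariety A 1
  -- a `ℂ`-basis of `H¹` made of rational classes
  set s : Set (complexBetti A.X 1) := {c | IsRationalClass c} with hs
  obtain ⟨b, hbs, hbspan, hbind⟩ := exists_linearIndependent ℂ s
  have hstop : Submodule.span ℂ s = ⊤ :=
    span_isRationalClass_eq_top_of_isSmoothProjective_holds (j + 1) A.X hX 1
  have hbtop : Submodule.span ℂ b = ⊤ := hbspan.trans hstop
  haveI : Finite b := hbind.finite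
  letI : Fintype b := Fintype.ofFinite b
  set r := Fintype.card b with hr
  let e : b ≃ Fin r := Fintype.equivFin b
  let u : Fin r → complexBetti A.X 1 := fun i => ((e.symm i : b) : complexBetti A.X 1)
  have hu : ∀ i, IsRationalClass (u i) := fun i => hbs (e.symm i).2
  have hui : LinearIndependent ℂ u := hbind.comp e.symm e.symm.injective
  have hrange : Set.range u = b := by
    ext x
    constructor
    · rintro ⟨i, rfl⟩
      exact (e.symm i).2
    · intro hx
      exact ⟨e ⟨x, hx⟩, by simp only [u, Equiv.symm_apply_apply]⟩
  have huspan : Submodule.span ℂ (Set.range u) = ⊤ := by rw [hrange, hbtop]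
  let B : Module.Basis (Fin r) ℂ (complexBetti A.X 1) := Module.Basis.mk hui (by rw [huspan])
  have hB : ∀ i, B i = u i := fun i => Module.Basis.mk_apply hui _ i
  have hBrat : ∀ i, IsRationalClass (B i) := fun i => by rw [hB]; exact hu i
  -- the rational matrix of `φ^*`
  have hφu : ∀ i, IsRationalClass (complexBetti.map φ.hom.hom.hom 1 (u i)) := fun i => (hu i).map _
  choose M hM using fun k i => repr_mem_range_ratCast_of_isRationalClass B hBrat (hφu i) k
  -- the top class
  obtain ⟨ω, hω, hω0⟩ := exists_isRationalClass_ne_zero_two_add_two_mul hX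
  have h1 := finrank_complexBetti_two_add_two_mul_eq_one hX
  choose G hG using fun i k =>
    exists_eq_ratCast_smul_of_finrank_eq_one h1 hω hω0
      (isRationalClass_polarizationPairingOne hη j (hu i) (hu k))
  obtain ⟨d, hd⟩ := exists_eq_ratCast_smul_of_finrank_eq_one h1 hω hω0 (isRationalClass_lefschetzPow hη j 2 hη)
  refine ⟨r, u, Matrix.of fun k i => M k i, ω, Matrix.of fun i k => G i k, d, hu, hui, huspan, ?_, hω,
    hω0, fun i k => by rw [Matrix.of_apply]; exact hG i k, hd⟩
  intro i
  conv_lhs => rw [← B.sum_repr (complexBetti.map φ.hom.hom.hom 1 (u i))]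
  refine Finset.sum_congr rfl fun k _ => ?_
  rw [Matrix.of_apply, hM k i, hB]

end Summit.HodgeConjecture.HodgeConjecture.Theorems

end
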